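import Summits.QuantumFields.YangMills.Theses.WilsonVillainDualStiffness

/-!
# Route `WilsonVillainDualStiffness`, glue item stmt-QuantumFields-26811 `WilsonDilutedVillainComparison_of_children`

`HelicityDualIdentity → HartmanWatsonMixture → CurrentSideDomination → WilsonDilutedVillainComparison` (children ⟹ parent),
with the comparison constant `c := 1` and the defect density `ρ :=` the Hartman–Watson hot fraction
`Θ{t > 1/(c₀β)} / Θ(ℝ)`, which the tail clause of `HartmanWatsonMixture` bounds by `e^{−c₀β}`; the right-hand side is rewritten into
the dual flux second moment by `HelicityDualIdentity`, after which `CurrentSideDomination` is the claim verbatim.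
Pure logic + `ENNReal.toReal` arithmetic (the planner's folder proof `ItemsGlue.lean`, re-typed; cell `ym-fleet`, width seat `ym-t4-w20`).

Nothing here proves a crux of the route, the node `U1HelicityGapTorusD4`, or any summit statement.
-/

namespace Summit.QuantumFields.YangMills.Theorems.WilsonVillainDualStiffness

open Summit.QuantumFields.YangMills.Theses.WilsonVillainDualStiffness

/-- Glue (children ⟹ parent) for `WilsonDilutedVillainComparison`: from the helicity/character-duality identity, the
Hartman–Watson mixture with hot-set tail `Θ{t > 1/(c₀β)} ≤ e^{−c₀β}·Θ(ℝ)`, and the current-side annealed-Villain domination,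
the Wilson torus helicity deficit dominates the annealed diluted Villain-dual flux variance with `c = 1` and
`ρ = Θ{t > 1/(c₀β)}/Θ(ℝ) ∈ [0, e^{−c₀β}]`. -/
theorem wilsonDilutedVillainComparison_of_children_proof : WilsonDilutedVillainComparison_of_children := by
  intro h1 h2 h3
  unfold HartmanWatsonMixture at h2
  unfold WilsonDilutedVillainComparison
  obtain ⟨c₀, hc₀, β₀, hΘ⟩ := h2
  refine ⟨1, one_pos, c₀, hc₀, max β₀ 0, fun β hβ => ?_⟩
  have hβ₀ : β₀ < β := lt_of_le_of_lt (le_max_left _ _) hβ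
  have hβ : 0 < β := lt_of_le_of_lt (le_max_right _ _) hβ
  obtain ⟨Θ, hfin, h0, hmom, htail⟩ := hΘ β hβ₀
  refine ⟨(Θ {t : ℝ | 1 / (c₀ * β) < t}).toReal / (Θ Set.univ).toReal,
    div_nonneg ENNReal.toReal_nonneg ENNReal.toReal_nonneg, ?_, fun N M hNM => ?_⟩
  · -- the hot fraction is at most `e^{−c₀β}`
    have hA : (Θ {t : ℝ | 1 / (c₀ * β) < t}).toReal
        ≤ Real.exp (-(c₀ * β)) * (Θ Set.univ).toReal := by
      have hne : ENNReal.ofReal (Real.exp (-(c₀ * β))) * Θ Set.univ ≠ ⊤ :=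
        ENNReal.mul_ne_top ENNReal.ofReal_ne_top (MeasureTheory.measure_ne_top Θ _)
      have := ENNReal.toReal_mono hne htail
      rwa [ENNReal.toReal_mul, ENNReal.toReal_ofReal (Real.exp_pos _).le] at this
    rcases eq_or_lt_of_le (ENNReal.toReal_nonneg : 0 ≤ (Θ Set.univ).toReal) with h | h
    · rw [← h, div_zero]
      exact (Real.exp_pos _).le
    · rw [div_le_iff₀ h]
      exact hA
  · rw [one_mul, h1 β hβ N M hNM]
    exact h3 β hβ c₀ hc₀ Θ hfin h0 hmom N M hNM

end Summit.QuantumFields.YangMills.Theorems.WilsonVillainDualStiffness
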